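import Mathlib.LinearAlgebra.Dual.Lemmas
import Mathlib.LinearAlgebra.FiniteDimensional.Lemmas
import Mathlib.Algebra.Field.ZMod
import Literature.Computability.MetaComplexity.SmolenskyProperty
import HarnessLib

/-!
# The indicator of an affine subspace of `𝔽₂ⁿ` of codimension `r` has degree `≤ r`
# (MacWilliams–Sloane Ch. 13 §4 Thm 7: "the incidence vector of any (m−r)-flat is in R(r,m)") — PROVED

Topic `Literature/Computability/MetaComplexity` (the degree filtration `Smolensky.lowDeg (ZMod 2) n D` of
`SmolenskyProperty.lean`).  Seat qa-qnc0-lit gen 10, for the cell qa-qnc0 (route `QuantumAdvantage/RingFrame`, planner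
qa-qnc0-p2 ROUND-5 THEOREMS E2/E3: "all `2^{m−e}` translates of the `e`-flat `S_x` represent the coset `x`", i.e. the
symmetric difference of two parallel `e`-flats — an `(e+1)`-flat — lies in `RM(m−e−1, m)`; and the TOP/STAR transversals).
The converse direction (minimum-weight words of `RM(r,m)` ARE flats, M–S Ch. 13 Thm 8) is the tree's
`CubicForrelation.NearExactIsExact.mw_flat_of_minweight` (cell bridge `AdviceFreeQNC0/DegreeBridge.lean`).

Source: F. J. MacWilliams, N. J. A. Sloane, *The Theory of Error-Correcting Codes* (1977), Ch. 13 §4, **Theorem 7**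
(held `book:macwilliamsnd-theory-error-correcting-codes`, chunk p0312): an `(m−r)`-flat is the set of solutions of `r`
independent linear(-affine) equations `Σ_j a_{ij} v_j = b_i`, so its incidence vector is `Π_{i=1}^{r} (Σ_j a_{ij} v_j + b_i + 1)`,
"a polynomial equation of degree `≤ r`".  We follow this proof, organised as an induction on the codimension: a flat
of codimension `r + 1` is the intersection of a flat of codimension `r` containing it with ONE affine hyperplane
(a linear functional vanishing on the smaller direction space and not on the larger — `Submodule.exists_dual_map_eq_bot_of_notMem`),
and a product of a degree-`≤ r` function with an affine function has degree `≤ r + 1` (`Smolensky.mul_mem_lowDeg_add`).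

## Contents (all proved)

* `Smolensky.affine_mem_lowDeg_one` — `u ↦ φ(û) + c` (`φ` a linear functional on `𝔽₂ⁿ`, `û` the `0/1` point of `u`) has degree `≤ 1`.
* `Smolensky.indicator_coset_mem_lowDeg` — for a subspace `W ≤ 𝔽₂ⁿ` with `n ≤ dim W + r` and any `x₀`, the indicator of
  the flat `x₀ + W` (as a function of `u ∈ {0,1}ⁿ` through `û`) lies in `lowDeg (ZMod 2) n r`.
* `Smolensky.indicator_coset_mem_lowDeg_sub` — the same with `r = n − dim W`.

WHAT THIS IS NOT: nothing about any summit statement; the decidability instance for `∈ W` is arbitrary (taken as an argument).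
-/

namespace Literature.Computability.MetaComplexity.Smolensky

open Module Submodule Finset

variable {n : ℕ}

/-- An affine function `u ↦ φ(û) + c` of the `0/1` point `û` of `u` has degree `≤ 1`.
[cite: MacWilliamsSloane1977, Ch. 13 §4 Thm. 7 (proof: each factor Σ_j a_ij v_j + b_i + 1 has degree ≤ 1)] -/
theorem affine_mem_lowDeg_one (φ : Module.Dual (ZMod 2) (Fin n → ZMod 2)) (c : ZMod 2) :
    (fun u : Fin n → Bool => φ (fun i => if u i then (1 : ZMod 2) else 0) + c) ∈ lowDeg (ZMod 2) n 1 := by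
  have key : (fun u : Fin n → Bool => φ (fun i => if u i then (1 : ZMod 2) else 0) + c) =
      ∑ i : Fin n, φ (fun j => if i = j then 1 else 0) • mono (ZMod 2) ({i} : Finset (Fin n)) +
        c • mono (ZMod 2) (∅ : Finset (Fin n)) := by
    funext u
    rw [Pi.add_apply, Finset.sum_apply, LinearMap.pi_apply_eq_sum_univ φ]
    congr 1
    · refine Finset.sum_congr rfl fun i _ => ?_
      rw [Pi.smul_apply, smul_eq_mul, smul_eq_mul, mul_comm, mono_apply]
      congr 1
      by_cases h : u i = true
      · rw [if_pos h, if_pos (fun j hj => by rwa [Finset.mem_singleton.1 hj])]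
      · rw [if_neg h, if_neg (fun h' => h (h' i (Finset.mem_singleton_self i)))]
    · rw [Pi.smul_apply, mono_empty, Pi.one_apply, smul_eq_mul, mul_one]
  rw [key]
  refine Submodule.add_mem _ (Submodule.sum_mem _ fun i _ => Submodule.smul_mem _ _ (mono_mem_lowDeg (by simp)))
    (Submodule.smul_mem _ _ (mono_mem_lowDeg (by simp)))

/-- **MacWilliams–Sloane Ch. 13 Thm 7** in the degree-filtration vocabulary: for a subspace `W ≤ 𝔽₂ⁿ` of codimension
`≤ r` (`n ≤ dim W + r`) and any `x₀`, the indicator of the flat `x₀ + W`, as a function of `u ∈ {0,1}ⁿ` through its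
`0/1` point `û`, has degree `≤ r`. [cite: MacWilliamsSloane1977, Ch. 13 §4 Thm. 7] -/
theorem indicator_coset_mem_lowDeg (x₀ : Fin n → ZMod 2) :
    ∀ (r : ℕ) (W : Submodule (ZMod 2) (Fin n → ZMod 2)) [DecidablePred (· ∈ W)],
      n ≤ finrank (ZMod 2) W + r →
        (fun u : Fin n → Bool =>
          if (fun i => if u i then (1 : ZMod 2) else 0) - x₀ ∈ W then (1 : ZMod 2) else 0) ∈ lowDeg (ZMod 2) n r := by
  intro r
  induction r with
  | zero =>
    intro W _ hW
    -- `W = ⊤`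
    have hn : finrank (ZMod 2) (Fin n → ZMod 2) = n := by rw [Module.finrank_pi, Fintype.card_fin]
    have htop : W = ⊤ := by
      apply Submodule.eq_top_of_finrank_eq
      rw [hn]
      exact le_antisymm ((Submodule.finrank_le W).trans hn.le) (by omega)
    have hall : ∀ v, v ∈ W := fun v => htop ▸ Submodule.mem_top
    have : (fun u : Fin n → Bool =>
        if (fun i => if u i then (1 : ZMod 2) else 0) - x₀ ∈ W then (1 : ZMod 2) else 0) = mono (ZMod 2) ∅ := by
      funext u; rw [if_pos (hall _), mono_empty, Pi.one_apply]
    rw [this]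
    exact mono_mem_lowDeg (by simp)
  | succ r ih =>
    intro W _ hW
    by_cases hle : n ≤ finrank (ZMod 2) W + r
    · exact lowDeg_mono (Nat.le_succ r) (ih W hle)
    -- codimension exactly `r + 1`: enlarge `W` by one vector `g ∉ W`
    have hn : finrank (ZMod 2) (Fin n → ZMod 2) = n := by rw [Module.finrank_pi, Fintype.card_fin]
    have hWtop : W ≠ ⊤ := by
      intro h
      have : finrank (ZMod 2) W = n := by rw [h, finrank_top, hn]
      omega
    obtain ⟨g, hg⟩ : ∃ g, g ∉ W := not_forall.1 fun h => hWtop (Submodule.eq_top_iff'.2 h)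
    set W' : Submodule (ZMod 2) (Fin n → ZMod 2) := W ⊔ (ZMod 2) ∙ g with hW'
    have hgW' : g ∈ W' := mem_sup_right (mem_span_singleton_self g)
    have hlt : W < W' := lt_of_le_of_ne le_sup_left fun h => hg (h ▸ hgW')
    have hdim : finrank (ZMod 2) W < finrank (ZMod 2) W' := Submodule.finrank_lt_finrank_of_lt hlt
    haveI : DecidablePred (· ∈ W') := Classical.decPred _
    have hF' := ih W' (by omega)
    -- a linear functional vanishing on `W` with `φ g = 1`
    obtain ⟨φ, hφg, hφW⟩ := Submodule.exists_dual_map_eq_bot_of_notMem hg inferInstance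
    have hφw : ∀ w ∈ W, φ w = 0 := fun w hw => by
      have : φ w ∈ W.map φ := mem_map_of_mem hw
      rw [hφW] at this
      exact (mem_bot _).1 this
    have h01 : ∀ z : ZMod 2, z = 0 ∨ z = 1 := by decide
    have hφg1 : φ g = 1 := (h01 (φ g)).resolve_left hφg
    -- the affine factor `ℓ(u) = 1 + φ(û − x₀)`
    have hℓ : (fun u : Fin n → Bool => φ (fun i => if u i then (1 : ZMod 2) else 0) + (1 - φ x₀)) ∈
        lowDeg (ZMod 2) n 1 := affine_mem_lowDeg_one φ _
    have key : (fun u : Fin n → Bool =>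
        if (fun i => if u i then (1 : ZMod 2) else 0) - x₀ ∈ W then (1 : ZMod 2) else 0) =
        (fun u : Fin n → Bool =>
          if (fun i => if u i then (1 : ZMod 2) else 0) - x₀ ∈ W' then (1 : ZMod 2) else 0) *
        (fun u : Fin n → Bool => φ (fun i => if u i then (1 : ZMod 2) else 0) + (1 - φ x₀)) := by
      funext u
      rw [Pi.mul_apply]
      set v : Fin n → ZMod 2 := (fun i => if u i then (1 : ZMod 2) else 0) - x₀ with hv
      have hφv : φ (fun i => if u i then (1 : ZMod 2) else 0) + (1 - φ x₀) = 1 + φ v := by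
        rw [hv, map_sub]; ring
      rw [hφv]
      by_cases hvW : v ∈ W
      · rw [if_pos hvW, if_pos (le_sup_left (b := (ZMod 2) ∙ g) hvW), hφw v hvW, add_zero, mul_one]
      · rw [if_neg hvW]
        by_cases hvW' : v ∈ W'
        · rw [if_pos hvW', one_mul]
          obtain ⟨w, hw, z, hz, hwz⟩ := mem_sup.1 hvW'
          obtain ⟨t, rfl⟩ := mem_span_singleton.1 hz
          have ht : t ≠ 0 := by
            rintro rfl
            rw [zero_smul, add_zero] at hwz
            exact hvW (hwz ▸ hw)
          have ht1 : t = 1 := (h01 t).resolve_left ht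
          rw [← hwz, map_add, map_smul, hφw w hw, ht1, hφg1, smul_eq_mul, mul_one, zero_add]
          decide
        · rw [if_neg hvW', zero_mul]
    rw [key]
    exact mul_mem_lowDeg_add hF' hℓ

/-- The same with the codimension written as `n − dim W`. [cite: MacWilliamsSloane1977, Ch. 13 §4 Thm. 7] -/
theorem indicator_coset_mem_lowDeg_sub (x₀ : Fin n → ZMod 2) (W : Submodule (ZMod 2) (Fin n → ZMod 2))
    [DecidablePred (· ∈ W)] :
    (fun u : Fin n → Bool =>
      if (fun i => if u i then (1 : ZMod 2) else 0) - x₀ ∈ W then (1 : ZMod 2) else 0) ∈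
      lowDeg (ZMod 2) n (n - finrank (ZMod 2) W) :=
  indicator_coset_mem_lowDeg x₀ _ W (by omega)

end Literature.Computability.MetaComplexity.Smolensky
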